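import Mathlib
import HarnessLib
import HarnessLib.Audit
import Summits.RiemannHypothesis.Statement
import Summits.RiemannHypothesis.RiemannHypothesis.Theorems.LiEchoDirichletDefs
import Summits.RiemannHypothesis.RiemannHypothesis.Theorems.LiPrimeEchoDefs
import Literature.NumberTheory.LFunctions.ExplicitFormulaPsiCharHeights
import Literature.NumberTheory.LFunctions.ExplicitFormulaPsiCharLogDeriv
import Literature.NumberTheory.LFunctions.DirichletXiConjugation
import Literature.NumberTheory.LFunctions.LandauGonekEdges
import Literature.Analysis.Complex.WeightedArgumentPrinciple
import Literature.Analysis.Fourier.WeightedStationaryPhase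
import Literature.Analysis.Fourier.StationaryPhaseLog
import HarnessLib.Audit.Status.Attr

/-!
Route: LiDirichletEcho

CLOSED (proved) 2026-08-26T15:10:47Z by operator:999:161901 — reason: proved:Summit.RiemannHypothesis.RiemannHypothesis.Theorems.LiTheory.liZeroWindowEchoDirichlet_proof. The file is kept as the record of this route; refuted decls are indexed as negative knowledge (`ledger negatives`).

# Route LiDirichletEcho — RH-free Li prime-echo law for Dirichlet characters — the √n-window of the
zero trace of L(s,χ) minus its Riemann–von Mangoldt mean is −Re χ(2)·A₂ n^(1/4) cos(2√(n log 2) +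
π/4) + O(log² n)

Column LI of the RH ladder (D-0040/D-0059/D-0061), round 4 = row L-D «Dirichlet twist»: the route
closes the RUNG LEAF
«Li PRIME-ECHO LAW FOR DIRICHLET CHARACTERS» (rung id assigned by 21-frontier; RH-FREE and GRH-FREE
for ALL n,
PROOF-OF-DATA, NOT height-buying): for every primitive Dirichlet character χ mod q > 1 and every
fixed `c ≥ 5/4` there is
`C` with `|Z_n(χ; √n, c√n) − S_n(χ; √n, c√n) + Re χ(2)·E₂(n)| ≤ C log² n` for all `n ≥ 2`, where
`Z_n(χ; T₁, T₂) =
charZeroTraceWindow χ n T₁ T₂ = Re Σ_{T₁<|Im ρ|≤T₂} m_ρ (1 − 1/ρ)ⁿ` over ALL zeros of L(s,χ) in the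
window (both signs of
Im ρ, any real part, multiplicity `DirichletDisc.zeroOrder`), `S_n(χ) = charSmoothTraceWindow χ =
(2/π)∫cos(nθ) g_χ` is
the character's Riemann–von Mangoldt mean (`g_χ(t) = ½ Re ψ((½+a+it)/2) + ½ log(q/π)`) and `E₂(n) =
liPrimeEcho 2 n =
A₂ n^{1/4} cos(2√(n log 2) + π/4)`, `A₂ = (log 2)^{1/4}/√(2π) = 0.36400`.  It suffices to show X =
LiWindowContourChar ∧
LiPrimeEdgeEchoChar ∧ LiGammaShiftChar ∧ LiHorizontalEdgesChar (the Assembly X → leaf is provable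
NOW from two RH-free
S/M-sized statements — the window-end adjustment and the conjugation split `Z(χ) = U(χ) + U(χ⁻¹)` of
the both-signs trace
— and the composition incl. the χ/χ̄ pairing is kernel-checked, HOME/theory/route/p5/SketchAll.lean,
farm rc 0, 0 sorries):
per character, Bombieri's rectangle `[−1/2, 3/2] × [T₁, T₂]` for `F_n·ξ'/ξ(·,χ)` (`ξ(s,χ) =
dirichletXi χ s`, entire: NO
polar edge) at good heights expresses TWICE the upper window trace through the right edge `Re w =
3/2`, where `ξ'/ξ(w,χ)
= ½log(q/π) + ½ψ((w+a)/2) − Σ Λ(m)χ(m)m^{−w}`: the left edge folds onto the right one because the χ̄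
of the functional
equation and the χ̄ of conjugation CANCEL (`ξ'/ξ(1−w̄,χ) = −conj ξ'/ξ(w,χ)`), giving the SAME
symmetrised weight `k_n =
F_n(w) + F_n(1−w)` as for ζ; the digamma piece shifted to the critical line IS the smooth mean; in
the prime piece exactly
one term resonates — `m = 2` against `F_n(1−w)`, stationary at `y = √(n/log 2) = 1.2011√n ∈ (√n,
c√n]` — and its value is
the TWISTED chirp `Re[χ(2)·A₂n^{1/4}e^{−iΦ}]`; summing χ and χ̄ (whose upper zeros are the
conjugates of χ's lower zeros)
turns the twist into `Re χ(2)·E₂(n)`; everything else is `O(log² n)`.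
Lean: `Summit.RiemannHypothesis.RiemannHypothesis.Theorems.LiTheory.LiZeroWindowEchoDirichlet`

## Assembly
Per character (`upper_law`, PROVED): for `c ≥ 5/4` and `n ≥ N = max(N_K, 64)` pick good heights `T₁
∈ [√n, √n+1]`,
`T₂ ∈ [c√n, c√n+1]` with `|H(T_i)| ≤ C₆ log² n` (K3χ); write `2U(√n,c√n) − S(√n,c√n) + twist =
2[U(√n,c√n) − U(T₁,T₂)] −
[S(√n,c√n) − S(T₁,T₂)] + (gamma − S(T₁,T₂)) − (prime − twist) + H(T₁) − H(T₂)` (K1χ,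
`linear_combination`); bound by
`3C₇ log n` (window adjustment `CharWindowAdjust`, S/M), `C₄ log n` (K4χ), `C₅ log² n` (K2χ), `2C₆
log² n`; total `≤ ((3|C₇|
+ |C₄|)/log 2 + 2|C₆| + |C₅|) log² n`.  Both signs (`liZeroWindowEchoDirichlet_of`, PROVED): apply
the per-character law
to χ and to χ⁻¹ (primitive with χ: `isPrimitive_inv`), use `charZeroTraceWindow χ = U(χ) + U(χ⁻¹)`
(`CharWindowConj`, S/M),
`charSmoothTraceWindow χ⁻¹ = charSmoothTraceWindow χ` (PROVED: parity and q shared) and `twist(χ 2)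
+ twist(χ⁻¹ 2) =
2 Re χ(2)·E₂` (`twist_pair`, PROVED from `χ⁻¹ 2 = conj(χ 2)` and `liPrimeEchoTwist_add_conj`),
halve, then «for all large n»
⇒ «for all n ≥ 2» (`eventually_to_all`, PROVED).  PROVABLE NOW: `assembly_of_supports :
CharWindowAdjust → CharWindowConj →
Assembly` is kernel-checked in HOME/theory/route/p5/SketchAll.lean (farm rc 0, 0 sorries) and
becomes the Assembly's birth
line (bc/Assembly_birth.lean: 2 stubs, composition PROVED).

CLOSES_TARGET: closes rung L-P(P1chi) of RiemannHypothesis: Summit.RiemannHypothesis.RiemannHypothesis.Theorems.LiTheory.LiZeroWindowEchoDirichlet (D-0061; not the summit Statement) — the deciding theorem of this route concludes that registered leaf instead of the Statement decl `RiemannHypothesis` (class rung: servable and labelled, never counted as concluding the summit Statement).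

Rationale: WHY THIS LINE. Row L-D of the LI ladder asks whether the √n-window echo law of round 3 (route
LiPrimeEcho, leaf `LiZeroWindowEcho`: the
chirp −E₂(n), data amplitude 0.3639 vs 0.3640) is a property of ζ or of the explicit formula; the
Dirichlet twist decides
it and the cell's data say «explicit formula»: ET3 (eng g3, kit j248329 + j248464, certified Arb
zeros of seven real
characters to height 1002, 400 n ∈ [10⁴, 2.5·10⁵]) found `D_χ(n) = −χ(2)E₂(n) + O(1)` with
amplitudes 0.977–0.992·A₂ and the
SIGN of −χ(2) in every class, SILENCE (≤ 0.012·A₂) for even moduli, and theory's kit j248812 (13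
complex and real
characters mod 5, 7, 9, 13, PARI zeros to 640) confirmed the pre-registered complex-character
predictions including the
quadrature silence of the order-4 characters and the law's complex form `W − S = −conj(χ(2))·E₂`.
The mechanism is the
Landau–Gonek explicit formula for L(s,χ) (Gonek1993; for characters with uniformity in q:
Bhowmik–Halupczok–Matsumoto–
Suzuki, arXiv:1704.06103 Prop. 2, `Σ_{|γ_χ|≤T} x^{ρ_χ} = −(T/π)χ(x)Λ(x) + …`; MontgomeryVaughan2007
§12.1) run with the
CHIRPED Li weight `(1 − 1/ρ)ⁿ`, so that the prime 2 enters through a stationary-phase point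
(Titchmarsh1986 Lemma 4.6 /
GrahamKolesnik1991, tree `Literature.Analysis.Fourier.weightedStationaryPhase_sharp`) with the
character value as its
coefficient.  Imported from another area: nothing beyond classical analytic number theory; what is
new is the object
(the √n-window of the Li zero trace of L(s,χ)) and the «window ↔ prime, character value ↔ amplitude»
dictionary, absent
from the Li-coefficient literature for Dirichlet L-functions (Li 2004 Ill. J. Math. 48; Mazhouda
2012 doi:10.1007/s00605-
012-0436-3; Omar–Ouni–Mazhouda 2011 doi:10.1112/s1461157010000215, which computes λ_χ(n) for n ≤ 40
and treats no
oscillation).  It is RH/GRH-free because `|z_ρⁿ| ≤ e^{1/2}` for every zero with `|Im ρ| ≥ √n`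
whatever its real part.

RANKED CRUXES. #2 LiPrimeEdgeEchoChar (crux) — (K2χ, the heart) For primitive χ mod q > 1, `c ≥
5/4`, all large `n` and window ends `T₁ ∈ [√n, √n+1]`, `T₂ ∈ [c√n, c√n+1]`: the PRIME piece of the
right edge, `charPrimeEdge χ n T₁ T₂ = (1/π) Re ∫ L(χΛ, 3/2+iy) k_n(3/2+iy) dy`, equals the twisted
echo `liPrimeEchoTwist (χ 2) 2 n = Re[χ(2)·A₂ n^{1/4} e^{−i(2√(n log 2)+π/4)}]` up to `C log² n`:
the term `Λ(2)χ(2)2^{−w}F_n(1−w)` is ζ's resonant integral times the constant χ(2) (phase `−(n/y + y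
log 2)`, stationary at `y₀ = √(n/log 2)`, margins `c√n − y₀ ≥ 0.049√n`, `y₀ − √n = 0.2√n`, curvature
`2(log 2)^{3/2}n^{−1/2}`, sharp weighted stationary phase); every other term (`F_n(w)` against any
m; `F_n(1−w)` against `m ≥ 3`, `|phase'| ≥ log 3 − 1`) is non-resonant, `|χ(m)| ≤ 1`, and O(1) by
the first-derivative test, summed absolutely. [difficulty: L] (why it might fail: resonant piece =
ζ's ×χ(2) (safe); risks: the stationary-phase remainder is O(1) only for FIXED c (endpoint term ≍
1/((c − 1.2011)√n·P″); data at c = 5/4, n ≤ 10⁵ still 30 % truncated) and a χ ↔ χ̄ slip in the twist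
(the leaf is immune: it carries Re χ(2)); constants may depend on q.) [Gonek1993,
MontgomeryVaughan2007, Titchmarsh1986, GrahamKolesnik1991, arXiv:1704.06103,
tree:Literature/Analysis/Fourier/WeightedStationaryPhase.lean]
#3 LiWindowContourChar (crux) — (K1χ) For primitive χ mod q > 1 and good heights `1 ≤ T₁ < T₂` (no
zero of `ξ(·,χ)` on `[−1/2, 3/2] × {T_i}`): `2·charUpperTraceWindow χ n T₁ T₂ = charGammaEdge χ n T₁
T₂ − charPrimeEdge χ n T₁ T₂ + charHorizTerm χ n T₁ − charHorizTerm χ n T₂` — the weighted argument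
principle on Bombieri's rectangle for `F_n · ξ'/ξ(·,χ)`, `ξ(s,χ) = dirichletXi χ s =
q^{(s+a)/2}·completedLFunction χ s` (ENTIRE for q > 1: no polar edge; zeros in the strip = the
non-trivial zeros of `χ.LFunction` with multiplicity `DirichletDisc.zeroOrder`, zero set
`lfunctionZeroBox`), the left edge `Re w = −1/2` folded onto `Re w = 3/2` by the functional equation
AND conjugation — `ξ'/ξ(1−w̄, χ) = −conj ξ'/ξ(w, χ)` (`ExplicitPsiChar.logDeriv_completed_one_sub` +
`DirichletTheta.conj_dirichletXi`: the χ̄'s cancel) — producing `k_n = F_n(w) + F_n(1−w)` and `2 Re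
Σ_upper`, and on `Re w = 3/2` the split `ξ'/ξ(w,χ) = ½log(q/π) + ½ψ((w+a)/2) − L(χΛ, w)` integrated
termwise. [difficulty: L] (why it might fail: the divisor dictionary dirichletXi χ ↔ χ.LFunction in
the closed strip (L(0,χ) = 0 for even χ but Re ρ > 0 in lfunctionZeroBox excludes it — check),
finiteness/multiplicity of ∑ᶠ, and an orientation/factor-2 slip (excluded numerically only for ζ,
j247923; an Arb check for one χ is the guard).) [Bombieri2000Weil, MontgomeryVaughan2007,
tree:Literature/Analysis/Complex/WeightedArgumentPrinciple.lean,
tree:Literature/NumberTheory/LFunctions/DirichletXiConjugation.lean,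
tree:Literature/NumberTheory/LFunctions/ExplicitFormulaPsiCharLogDeriv.lean]
#4 LiGammaShiftChar (crux) — (K4χ) For `c ≥ 1`, large `n`, `√n ≤ T₁ < T₂ ≤ c√n + 1`: `|charGammaEdge
χ n T₁ T₂ − charSmoothTraceWindow χ n T₁ T₂| ≤ C log n` — Cauchy on `[1/2, 3/2] × [T₁, T₂]` for the
analytic integrand `(½log(q/π) + ½ψ((w+a)/2)) k_n(w)` moves the gamma piece to the critical line,
where it is EXACTLY the smooth mean: `k_n(½+it) = 2cos(nθ(t))` and `½ Re ψ((½+a+it)/2) + ½log(q/π) =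
charGammaDensity χ t`; the two horizontal connectors cost `O(log(q(T+4)))·(1 + e) = O(log n)`.
[difficulty: M] (why it might fail: needs the exact identification on the critical line with the
parity shift a inside ψ((w+a)/2) and |F_n(1−w)| ≤ e for Re w ≥ ½, Im w ≥ √n; a factor ½ or a wrong
parity branch leaves an O(√n) discrepancy and the item is false as typed (kit: this density
reproduces all 13 zero counts to O(1)).) [MontgomeryVaughan2007, Titchmarsh1986,
tree:Literature/NumberTheory/LFunctions/WeilExplicitDirichlet.lean]
#5 LiHorizontalEdgesChar (crux) — (K3χ) For `c ≥ 1`, large `n` and every `T ∈ [√n, c√n]` there is a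
GOOD height `T' ∈ [T, T+1]` (no zero of `ξ(·,χ)` on `[−1/2, 3/2] × {T'}`) with `|charHorizTerm χ n
T'| ≤ C log² n`: Montgomery–Vaughan Lemma 12.7 good heights for L(s,χ)
(`ExplicitPsiChar.exists_goodHeight`), the strip bound `‖L'/L(σ+iT',χ)‖ ≤ C(log q + log(T'+4))/η` on
`σ ∈ [−1/2, 3/2]` (`ExplicitPsiChar.exists_norm_logDeriv_LFunction_le_strip`) transported to `ξ'/ξ`
by the digamma bound, `|F_n(σ+iT')| ≤ (1 + 2/T'²)^{n/2} ≤ e` for `σ ≥ −1/2`, `T' ≥ √n`, segment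
length 2. [difficulty: M] (why it might fail: low risk — inputs are tree theorems; residual work =
interval-integrability of `σ ↦ ξ'/ξ(σ+iT',χ)·F_n(σ+iT')` on the closed segment and the passage `L'/L
↔ ξ'/ξ` (adds ½|ψ((s+a)/2)| + ½log(q/π) = O(log qT)); constants depend on q (allowed).)
[MontgomeryVaughan2007, Bombieri2000Weil,
tree:Literature/NumberTheory/LFunctions/ExplicitFormulaPsiCharHeights.lean,
tree:Literature/NumberTheory/LFunctions/ExplicitFormulaPsiCharLogDeriv.lean]

TWO-LAYER PLAN. Foreseen glued splits = the birth skeletons HOME/theory/route/p5/bc/: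
LiPrimeEdgeEchoChar ⇐ stub_m2_twisted (L: the resonant
piece `(1/π)Re∫Λ(2)χ(2)2^{−w}F_n(1−w) = liPrimeEchoTwist (χ 2) 2 n + O(log n)` = ζ's
stub_m2_stationary × χ(2)) →
stub_nonresonant_char (M: the rest is O(1), first-derivative test with |χ(m)| ≤ 1);
LiWindowContourChar ⇐ stub_rect_char (M:
argument principle for dirichletXi on the rectangle) → stub_leftfold_char (S/M: the conjugation fold
and the right-edge
split); LiGammaShiftChar ⇐ stub_gamma_shift_char → stub_gamma_connector_char; LiHorizontalEdgesChar
⇐ stub_goodHeight_char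
(MV 12.7) → stub_horiz_pointwise_char; Assembly ⇐ stub_window_adjust_char → stub_window_conj
(composition PROVED).  The ζ
route's stubs (LiPrimeEcho, items 19245–19249) are the m-by-m templates: a prover who closes one
closes its χ-twin cheaply.

KILL CRITERIA. (i) A certified evaluation (Arb, as ET1) of the identity LiWindowContourChar for two
characters (one even, one odd) at two
good windows with the known zeros that leaves a residual of the size of one zero's term kills K1χ AS
TYPED (orientation /
factor 2 / parity slip) — repair by restatement, not fatal to the line.  (ii) K2χ dies as typed if
`charPrimeEdge χ −
liPrimeEchoTwist (χ 2) 2 n` evaluated numerically for χ mod 5 (order 4) and mod 7 (order 3) does not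
stay O(log² n) —
if it tracks the conjugate twist the statement is misstated (swap χ ↔ χ̄ in `liPrimeEchoTwist`; the
LEAF is immune: it
carries Re χ(2)).  (iii) The LEAF dies only if certified zero data contradict it: a primitive
character whose c = 2 window
statistic has a cos-coefficient off −Re χ(2) by more than the O(log² n)/n^{1/4} budget on a
certified range (ET3: 7/7 real
characters pass; j248812: 13/13 pass at tolerance 0.06) — then close `refuted:<leaf>` via the
negative statement.  Proved
elsewhere that moots it: a chirped/twisted Landau–Gonek theorem for L(s,χ) with the Li weight in
print (none found).

NOT DECOMPOSED YET. The stubs of the two-layer plan are lines, not items (BC6: cone = four cruxes +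
Assembly).  Later rungs, not this route:
the COMPLEX form `LiZeroWindowEchoDirichletComplex` (W − S = −conj(χ(2))E₂; typed companion, complex
⇒ leaf PROVED; needs
the Im-channel of K1χ with the antisymmetrised weight F_n(w) − F_n(1−w)), the antisymmetric law Σ
sgn(Im ρ)Re z_ρⁿ =
−Im χ(2)A₂n^{1/4}sin Φ (no smooth term), the general window law `LiZeroWindowEchoesDirichlet`
(amplitudes Re χ(m)A_m), the
q-uniform version (constants C(c)·log² (qn)), and the family average over χ mod q (orthogonality
kills every m ≢ ±1-type
residue class — a «Dirichlet echo sieve»).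

CHEAPEST FALSIFIER. RUN: (a) ET3 (eng g3, kit j248329/j248464; DATA.md v5 §I): real characters D ∈
{−3, −4, 5, −7, 8, −8} + ζ, certified zeros,
c = 2, n ≤ 2.5·10⁵: cos-coefficients −0.984 (ζ), +0.988 (−3), +0.995 (5), −0.990 (−7), |·| ≤ 0.012
(−4, 8, −8) vs −χ(2) —
PASS 7/7; (b) theory kit j248812 (PARI zeros |γ| ≤ 640, 13 characters mod 5, 7, 9, 13 + ζ, 200 n ∈
[10⁴, 10⁵], c = 2):
every fitted (cos, sin) coefficient of Z − S, of the imaginary trace, of the antisymmetric and odd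
statistics within 0.06
of (−Re χ(2), 0), (+Im χ(2), 0), (0, −Im χ(2)), (0, −Re χ(2)) — PASS 13/13 (one 0.066 where PARI
dropped 4 zeros).  The
remaining cheapest falsifier is FORMAL and cheap: instantiate K1χ's fold for an ODD character (a =
1) — the identity
`ξ'/ξ(1−w̄,χ) = −conj ξ'/ξ(w,χ)` must hold with `dirichletXi`'s normalisation `q^{(s+a)/2}`; a
refuter checks it from
`DirichletTheta.conj_dirichletXi` + `dirichletXi_one_sub` in ten lines, and a mismatch kills K1χ as
typed.

NUMBERS. `A₂ = (log 2)^{1/4}/√(2π) = 0.364001`; stationary heights `t₀(m)/√n = (log m)^{−1/2}` =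
1.2011 (2), 0.9541 (3), 0.8494 (4):
the window `(√n, c√n]`, `c ≥ 5/4`, contains exactly `t₀(2)`.  Smooth density both signs `(2/π)g_χ(t)
≈ (1/π)log(qt/2π)`;
zero counts |γ| ≤ 640 (j248812): 1067 (q = 5), 1134 (7), 1184 (9), 1260 (13) vs RvM main term within
0.6–3.6.  DATA: ET3
amplitudes a₂/A₂ = 0.977 (ζ), 0.988 (−3), 0.989 (5), 0.992 (−7), 0.009/0.005/0.012 (−4/8/−8), phases
0.80–0.82 vs π/4 =
0.785; j248812 at c = 2: see Cheapest falsifier; at c = 5/4 amplitudes ≈ 0.70·prediction for n ≤ 10⁵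
(endpoint inside the
Fresnel width 0.93 n^{1/4} until n ≈ 3·10⁵; the leaf's ∃C absorbs it).

DEFINITION REQUESTS. None: PART E vocabulary (`charZeroTrace`, `charZeroTraceWindow`,
`charUpperZeroTrace`, `charUpperTraceWindow`,
`charGammaDensity`, `charSmoothTraceWindow`, `liPrimeEchoTwist` (+ `_one/_add_conj/_zero` PROVED),
`charRightEdge`,
`charHorizTerm`, `charGammaEdge`, `charPrimeEdge`, `charGoodHeights`, `charZeroTraceC`,
`charZeroTraceWindowC`), the leaf
`LiZeroWindowEchoDirichlet` and its companions (`LiZeroWindowSilentDirichlet`,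
`LiZeroWindowEchoesDirichlet`,
`LiZeroWindowEchoDirichletComplex`, glue PROVED) are in
HOME/theory/route/p5/LiEchoDirichletDefs.lean (farm rc 0, 0 sorries),
to be landed by a prover as
`Summits/RiemannHypothesis/RiemannHypothesis/Theorems/LiEchoDirichletDefs.lean` (`ledger propose
--kind definition`) and the leaf registered as an alternative closer (rung id by 21-frontier,
D-0061) before `route open`.

Novelty: Searches (2026-08-26): lit search --hybrid "Li coefficients Dirichlet L-functions oscillations
Keiper numerical" (Steuding LNM 1877 pp.205/262; Inam–Büyükaşık school notes p.164; no oscillation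
law); lit vsearch "<the leaf in prose: window sum over zeros of L(s,χ) of (1−1/ρ)^n minus smooth
mean equals −χ(2) n^(1/4) cos(2√(n log 2)+π/4), twisted Landau–Gonek with stationary phase>" -k 10
(MontgomeryVaughan2007 pp.275/256 explicit-formula pages; nothing closer); lit search "Li
coefficients Dirichlet L-functions Omar Mazhouda" --source all (hits: Mazhouda Monatsh. 2012
doi:10.1007/s00605-012-0436-3; Li Ill. J. Math. 48 (2004) zbl:1061.11048; and Omar–Ouni–Mazhouda LMS
JCM 14 (2011) doi:10.1112/s1461157010000215 — RETRACTED by the journal, retraction notice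
doi:10.1112/s1461157018000013 (zbMATH «retracted»): listed here only because the search returned it;
NOT relied on anywhere in this route); lit search "zeros of Dirichlet L-functions sum x^rho Landau
Gonek formula character" --source all (Bhowmik–Halupczok–Matsumoto–Suzuki arXiv:1704.06103 Prop. 2;
Laaksonen–Petridis arXiv:1505.00623 p.4; Aryan JNT 2022 doi:10.1016/j.jnt.2021.06.015; Liu–Wang Acta
Arith. 2002 doi:10.4064/aa102-3-5); lit galaxy search "Landau-Gonek|Gonek's formula|formula of
Landau|Landau's formula" --star all (Gonek pdf:1374564760; BHMS pdf:5188209152039225460;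
Laaksonen–Petridis pdf:-5382741698286726860); lit galaxy search "Li coefficients for
Dirichlet|generalized Li coefficients|Li's criterion for Dirichlet  [refs: 10.1007/s00605-012-0436-3, 10.1112/s1461157010000215, 10.1112/s1461157018000013, 10.1016/j.jnt.2021.06.015, 10.4064/aa102-3-5, 1704.06103, 1505.00623, 1507.03431, math/0404394, doi:10.1007/s00605-012-0436-3, doi:10.1112/s1461157010000215, doi:10.1112/s1461157018000013, doi:10.1016/j.jnt.2021.06.015, doi:10.4064/aa102-3-5, paper:arxiv-1704.06103, MontgomeryVaughan2007]

Barriers (technique_class: explicit-formula-contour, stationary-phase, dirichlet-twist): - technique_class: explicit-formula-contour, stationary-phase, dirichlet-twist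
- Literature.Barriers.RiemannHypothesis.BoundedFluctuationCounting: outside — the barrier forbids
COUNTING laws with bounded fluctuation (S(T) = Ω±); the leaf is a WEIGHTED window law with error
O(log² n) ≫ S(T,χ) = O(log qT), and S never enters (contour at good heights)
[corpus:paper:arxiv-math_0404394 p.4 for the ζ analogue; no hits for "Li coefficients|Keiper-Li" ×
"S(T)|Selberg" for characters in corpus(fts+vec) and galaxy].
- Literature.Barriers.RiemannHypothesis.LindelofBacklund / GramRosserFailures: outside — no size ⇒
zero-free upgrade, no Gram law; zeros enter only through the argument principle with multiplicity at
any real part.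
- Literature.Barriers.RiemannHypothesis.NymanBeurlingObstructions / MollifierLimitations /
BerryKeatingOperator: not this route's class; the leaf is labelled NOT evidence for RH/GRH and NOT
RH-sensitive (|z_ρⁿ| ≤ e^(1/2) off the line too).
- Siegel/exceptional-zero phenomena: irrelevant — a real zero near 1 of L(s,χ) has |Im ρ| = 0 < √n
and never enters the window; constants may depend on q.
- Negatives index: `ledger negatives --problem RiemannHypothesis` (2026-08-26): 2 refuted statements
(Jacobi-symbol sine-sum positivity; de Bruijn universal-factor real zeros) — none about Li/Keiper
coefficients, explicit formulae, characters or window sums.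

History (route lifecycle, newest last):
- 2026-08-26T15:10:47Z · CLOSED proved — proved:Summit.RiemannHypothesis.RiemannHypothesis.Theorems.LiTheory.liZeroWindowEchoDirichlet_proof (operator:999:161901)

sub-problem: RiemannHypothesis · status: closed(proved) · opened planner-rh-li-theory-g7-0 2026-08-26T05:06:08Z · rev 5 · ledger route-RiemannHypothesis-LiDirichletEcho
GENERATED by the gate from the ledger (D-0016/17). Provers cite these decls: `theorem foo : Summit.RiemannHypothesis.RiemannHypothesis.Theses.LiDirichletEcho.<Decl> := …` in Summits/RiemannHypothesis/RiemannHypothesis/Theorems/<Name>.lean.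
-/

namespace Summit.RiemannHypothesis.RiemannHypothesis.Theses.LiDirichletEcho

open scoped BigOperators Topology Manifold Classical MeasureTheory ProbabilityTheory Matrix InnerProductSpace ComplexConjugate ContinuousMap
open Filter Set Function TopologicalSpace MeasureTheory

attribute [summit_statement] _root_.Summit.RiemannHypothesis
attribute [summit_statement] _root_.Summit.RiemannHypothesis.RiemannHypothesis.Theorems.LiTheory.LiZeroWindowEchoDirichlet

open Summit

/-- item stmt-RiemannHypothesis-19393 · crux · rank 2 · closed · proved by Summit.RiemannHypothesis.RiemannHypothesis.Theorems.LiTheory.liPrimeEdgeEchoChar_proof (prover) · by planner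
why it might fail: resonant piece = ζ's ×χ(2) (safe); risks: the stationary-phase remainder is O(1) only for FIXED c (endpoint term ≍ 1/((c − 1.2011)√n·P″); data at c = 5/4, n ≤ 10⁵ still 30 % truncated) and a χ ↔ χ̄ slip in the twist (the leaf is immune: it carries Re χ(2)); constants may depend on q.
sources: Gonek1993, MontgomeryVaughan2007, Titchmarsh1986, GrahamKolesnik1991, arXiv:1704.06103, tree:Literature/Analysis/Fourier/WeightedStationaryPhase.lean
[crux] (K2χ, the heart) For primitive χ mod q > 1, `c ≥ 5/4`, all large `n` and window ends `T₁ ∈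
[√n, √n+1]`, `T₂ ∈ [c√n, c√n+1]`: the PRIME piece of the right edge, `charPrimeEdge χ n T₁ T₂ =
(1/π) Re ∫ L(χΛ, 3/2+iy) k_n(3/2+iy) dy`, equals the twisted echo `liPrimeEchoTwist (χ 2) 2 n =
Re[χ(2)·A₂ n^{1/4} e^{−i(2√(n log 2)+π/4)}]` up to `C log² n`: the term `Λ(2)χ(2)2^{−w}F_n(1−w)` is
ζ's resonant integral times the constant χ(2) (phase `−(n/y + y log 2)`, stationary at `y₀ = √(n/log
2)`, margins `c√n − y₀ ≥ 0.049√n`, `y₀ − √n = 0.2√n`, curvature `2(log 2)^{3/2}n^{−1/2}`, sharp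
weighted stationary phase); every other term (`F_n(w)` against any m; `F_n(1−w)` against `m ≥ 3`,
`|phase'| ≥ log 3 − 1`) is non-resonant, `|χ(m)| ≤ 1`, and O(1) by the first-derivative test, summed
absolutely. [difficulty: L] -/
@[route_item "route-RiemannHypothesis-LiDirichletEcho", crux]
def LiPrimeEdgeEchoChar : Prop :=
  ∀ (q : ℕ) [NeZero q] (χ : DirichletCharacter ℂ q), χ.IsPrimitive → 1 < q → ∀ c : ℝ, 5 / 4 ≤ c → ∃ N : ℕ, ∃ C : ℝ, ∀ n : ℕ, N ≤ n → ∀ T₁ T₂ : ℝ, Real.sqrt n ≤ T₁ → T₁ ≤ Real.sqrt n + 1 → c * Real.sqrt n ≤ T₂ → T₂ ≤ c * Real.sqrt n + 1 → |Summit.RiemannHypothesis.RiemannHypothesis.Theorems.LiTheory.charPrimeEdge χ n T₁ T₂ - Summit.RiemannHypothesis.RiemannHypothesis.Theorems.LiTheory.liPrimeEchoTwist (χ (2 : ZMod q)) 2 n| ≤ C * Real.log n ^ 2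

-- `LiPrimeEdgeEchoChar` holds: proved by `Summit.RiemannHypothesis.RiemannHypothesis.Theorems.LiTheory.liPrimeEdgeEchoChar_proof` (its module imports this route file, so no `_holds` link can be stated here).

/-- item stmt-RiemannHypothesis-19399 · crux · rank 3 · closed · proved by Summit.RiemannHypothesis.RiemannHypothesis.Theorems.LiTheory.liWindowContourChar_proof (prover) · by planner
why it might fail: the divisor dictionary dirichletXi χ ↔ χ.LFunction in the closed strip (L(0,χ) = 0 for even χ but Re ρ > 0 in lfunctionZeroBox excludes it — check), finiteness/multiplicity of ∑ᶠ, and an orientation/factor-2 slip (excluded numerically only for ζ, j247923; an Arb check for one χ is the guard).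
sources: Bombieri2000Weil, MontgomeryVaughan2007, tree:Literature/Analysis/Complex/WeightedArgumentPrinciple.lean, tree:Literature/NumberTheory/LFunctions/DirichletXiConjugation.lean, tree:Literature/NumberTheory/LFunctions/ExplicitFormulaPsiCharLogDeriv.lean
[crux] (K1χ) For primitive χ mod q > 1 and good heights `1 ≤ T₁ < T₂` (no zero of `ξ(·,χ)` on
`[−1/2, 3/2] × {T_i}`): `2·charUpperTraceWindow χ n T₁ T₂ = charGammaEdge χ n T₁ T₂ − charPrimeEdge
χ n T₁ T₂ + charHorizTerm χ n T₁ − charHorizTerm χ n T₂` — the weighted argument principle on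
Bombieri's rectangle for `F_n · ξ'/ξ(·,χ)`, `ξ(s,χ) = dirichletXi χ s =
q^{(s+a)/2}·completedLFunction χ s` (ENTIRE for q > 1: no polar edge; zeros in the strip = the
non-trivial zeros of `χ.LFunction` with multiplicity `DirichletDisc.zeroOrder`, zero set
`lfunctionZeroBox`), the left edge `Re w = −1/2` folded onto `Re w = 3/2` by the functional equation
AND conjugation — `ξ'/ξ(1−w̄, χ) = −conj ξ'/ξ(w, χ)` (`ExplicitPsiChar.logDeriv_completed_one_sub` +
`DirichletTheta.conj_dirichletXi`: the χ̄'s cancel) — producing `k_n = F_n(w) + F_n(1−w)` and `2 Re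
Σ_upper`, and on `Re w = 3/2` the split `ξ'/ξ(w,χ) = ½log(q/π) + ½ψ((w+a)/2) − L(χΛ, w)` integrated
termwise. [difficulty: L] -/
@[route_item "route-RiemannHypothesis-LiDirichletEcho", crux]
def LiWindowContourChar : Prop :=
  ∀ (q : ℕ) [NeZero q] (χ : DirichletCharacter ℂ q), χ.IsPrimitive → 1 < q → ∀ (n : ℕ) (T₁ T₂ : ℝ), 1 ≤ T₁ → T₁ < T₂ → T₁ ∈ Summit.RiemannHypothesis.RiemannHypothesis.Theorems.LiTheory.charGoodHeights χ → T₂ ∈ Summit.RiemannHypothesis.RiemannHypothesis.Theorems.LiTheory.charGoodHeights χ → 2 * Summit.RiemannHypothesis.RiemannHypothesis.Theorems.LiTheory.charUpperTraceWindow χ n T₁ T₂ = Summit.RiemannHypothesis.RiemannHypothesis.Theorems.LiTheory.charGammaEdge χ n T₁ T₂ - Summit.RiemannHypothesis.RiemannHypothesis.Theorems.LiTheory.charPrimeEdge χ n T₁ T₂ + Summit.RiemannHypothesis.RiemannHypothesis.Theorems.LiTheory.charHorizTerm χ n T₁ - Summit.RiemannHypothesis.RiemannHypothesis.Theorems.LiTheory.charHorizTerm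 χ n T₂

-- `LiWindowContourChar` holds: proved by `Summit.RiemannHypothesis.RiemannHypothesis.Theorems.LiTheory.liWindowContourChar_proof` (its module imports this route file, so no `_holds` link can be stated here).

/-- item stmt-RiemannHypothesis-19400 · crux · rank 4 · closed · proved by Summit.RiemannHypothesis.RiemannHypothesis.Theorems.LiTheory.liGammaShiftChar_proof (prover) · by planner
why it might fail: needs the exact identification on the critical line with the parity shift a inside ψ((w+a)/2) and |F_n(1−w)| ≤ e for Re w ≥ ½, Im w ≥ √n; a factor ½ or a wrong parity branch leaves an O(√n) discrepancy and the item is false as typed (kit: this density reproduces all 13 zero counts to O(1)).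
sources: MontgomeryVaughan2007, Titchmarsh1986, tree:Literature/NumberTheory/LFunctions/WeilExplicitDirichlet.lean
[crux] (K4χ) For `c ≥ 1`, large `n`, `√n ≤ T₁ < T₂ ≤ c√n + 1`: `|charGammaEdge χ n T₁ T₂ −
charSmoothTraceWindow χ n T₁ T₂| ≤ C log n` — Cauchy on `[1/2, 3/2] × [T₁, T₂]` for the analytic
integrand `(½log(q/π) + ½ψ((w+a)/2)) k_n(w)` moves the gamma piece to the critical line, where it is
EXACTLY the smooth mean: `k_n(½+it) = 2cos(nθ(t))` and `½ Re ψ((½+a+it)/2) + ½log(q/π) =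
charGammaDensity χ t`; the two horizontal connectors cost `O(log(q(T+4)))·(1 + e) = O(log n)`.
[difficulty: M] -/
@[route_item "route-RiemannHypothesis-LiDirichletEcho", crux]
def LiGammaShiftChar : Prop :=
  ∀ (q : ℕ) [NeZero q] (χ : DirichletCharacter ℂ q), χ.IsPrimitive → 1 < q → ∀ c : ℝ, 1 ≤ c → ∃ N : ℕ, ∃ C : ℝ, ∀ n : ℕ, N ≤ n → ∀ T₁ T₂ : ℝ, Real.sqrt n ≤ T₁ → T₁ < T₂ → T₂ ≤ c * Real.sqrt n + 1 → |Summit.RiemannHypothesis.RiemannHypothesis.Theorems.LiTheory.charGammaEdge χ n T₁ T₂ - Summit.RiemannHypothesis.RiemannHypothesis.Theorems.LiTheory.charSmoothTraceWindow χ n T₁ T₂| ≤ C * Real.log n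

-- `LiGammaShiftChar` holds: proved by `Summit.RiemannHypothesis.RiemannHypothesis.Theorems.LiTheory.liGammaShiftChar_proof` (its module imports this route file, so no `_holds` link can be stated here).

/-- item stmt-RiemannHypothesis-19401 · crux · rank 5 · closed · proved by Summit.RiemannHypothesis.RiemannHypothesis.Theorems.LiTheory.liHorizontalEdgesChar_proof (prover) · by planner
why it might fail: low risk — inputs are tree theorems; residual work = interval-integrability of `σ ↦ ξ'/ξ(σ+iT',χ)·F_n(σ+iT')` on the closed segment and the passage `L'/L ↔ ξ'/ξ` (adds ½|ψ((s+a)/2)| + ½log(q/π) = O(log qT)); constants depend on q (allowed).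
sources: MontgomeryVaughan2007, Bombieri2000Weil, tree:Literature/NumberTheory/LFunctions/ExplicitFormulaPsiCharHeights.lean, tree:Literature/NumberTheory/LFunctions/ExplicitFormulaPsiCharLogDeriv.lean
[crux] (K3χ) For `c ≥ 1`, large `n` and every `T ∈ [√n, c√n]` there is a GOOD height `T' ∈ [T, T+1]`
(no zero of `ξ(·,χ)` on `[−1/2, 3/2] × {T'}`) with `|charHorizTerm χ n T'| ≤ C log² n`:
Montgomery–Vaughan Lemma 12.7 good heights for L(s,χ) (`ExplicitPsiChar.exists_goodHeight`), the
strip bound `‖L'/L(σ+iT',χ)‖ ≤ C(log q + log(T'+4))/η` on `σ ∈ [−1/2, 3/2]`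
(`ExplicitPsiChar.exists_norm_logDeriv_LFunction_le_strip`) transported to `ξ'/ξ` by the digamma
bound, `|F_n(σ+iT')| ≤ (1 + 2/T'²)^{n/2} ≤ e` for `σ ≥ −1/2`, `T' ≥ √n`, segment length 2.
[difficulty: M] -/
@[route_item "route-RiemannHypothesis-LiDirichletEcho", crux]
def LiHorizontalEdgesChar : Prop :=
  ∀ (q : ℕ) [NeZero q] (χ : DirichletCharacter ℂ q), χ.IsPrimitive → 1 < q → ∀ c : ℝ, 1 ≤ c → ∃ N : ℕ, ∃ C : ℝ, ∀ n : ℕ, N ≤ n → ∀ T : ℝ, Real.sqrt n ≤ T → T ≤ c * Real.sqrt n → ∃ T' : ℝ, T ≤ T' ∧ T' ≤ T + 1 ∧ T' ∈ Summit.RiemannHypothesis.RiemannHypothesis.Theorems.LiTheory.charGoodHeights χ ∧ |Summit.RiemannHypothesis.RiemannHypothesis.Theorems.LiTheory.charHorizTerm χ n T'| ≤ C * Real.log n ^ 2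

-- `LiHorizontalEdgesChar` holds: proved by `Summit.RiemannHypothesis.RiemannHypothesis.Theorems.LiTheory.liHorizontalEdgesChar_proof` (its module imports this route file, so no `_holds` link can be stated here).

/-- item stmt-RiemannHypothesis-19403 · support · rank 9 · closed · proved by Summit.RiemannHypothesis.RiemannHypothesis.Theorems.LiTheory.charWindowAdjust_proof (prover) · by planner
sources: MontgomeryVaughan2007, tree:Literature/NumberTheory/LFunctions/ExplicitFormulaPsiCharHeights.lean
[support] window-end adjustment (RH-free, GRH-free, size M): moving the window ends by ≤ 1 inside
[√n, √n+1] and [c√n, c√n+1] costs O(log n) on the upper zero trace of L(s,χ) (O(log q(T+2)) zeros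
per unit window, tree ExplicitFormulaPsiCharHeights.exists_sum_window_le; |z_ρ^n| ≤ e^{1/2} for Im ρ
≥ √n at ANY real part) and on the smooth mean (charGammaDensity χ t ≤ ½ log(q(t+2))). First of the
two skeleton statements from which the route Assembly is PROVED (assembly_of_supports,
HOME/theory/route/p5/SketchAll.lean; skeleton stub stub_window_adjust_char). Sources:
MontgomeryVaughan2007 (Lemma 12.7, Cor. 14.3); tree ExplicitFormulaPsiCharHeights. -/
@[route_item "route-RiemannHypothesis-LiDirichletEcho"]
def CharWindowAdjust : Prop :=
  ∀ (q : ℕ) [NeZero q] (χ : DirichletCharacter ℂ q), χ.IsPrimitive → 1 < q → ∀ c : ℝ, 1 ≤ c → ∃ N : ℕ, ∃ C : ℝ, ∀ n : ℕ, N ≤ n → ∀ T₁ T₂ : ℝ, Real.sqrt n ≤ T₁ → T₁ ≤ Real.sqrt n + 1 → c * Real.sqrt n ≤ T₂ → T₂ ≤ c * Real.sqrt n + 1 → |Summit.RiemannHypothesis.RiemannHypothesis.Theorems.LiTheory.charUpperTraceWindow χ n (Real.sqrt n) (c * Real.sqrt n) - Summit.RiemannHypothesis.RiemannHypothesis.Theorems.LiTheory.charUpperTraceWindow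 χ n T₁ T₂| ≤ C * Real.log n ∧ |Summit.RiemannHypothesis.RiemannHypothesis.Theorems.LiTheory.charSmoothTraceWindow χ n (Real.sqrt n) (c * Real.sqrt n) - Summit.RiemannHypothesis.RiemannHypothesis.Theorems.LiTheory.charSmoothTraceWindow χ n T₁ T₂| ≤ C * Real.log n

-- `CharWindowAdjust` holds: proved by `Summit.RiemannHypothesis.RiemannHypothesis.Theorems.LiTheory.charWindowAdjust_proof` (its module imports this route file, so no `_holds` link can be stated here).

/-- item stmt-RiemannHypothesis-19404 · support · rank 9 · closed · proved by Summit.RiemannHypothesis.RiemannHypothesis.Theorems.LiTheory.charWindowConj_proof (prover) · by planner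
sources: MontgomeryVaughan2007, tree:Literature/NumberTheory/LFunctions/DirichletXiConjugation.lean
[support] conjugation split of the both-signs trace (RH-free, GRH-free, size S/M): the zeros of
L(s,χ) with Im ρ < 0 are the complex conjugates of the zeros of L(s,χ̄) = L(s,χ⁻¹) with Im ρ > 0,
with the same multiplicity (conj L(s̄,χ) = L(s,χ̄); DirichletDisc.zeroOrder χ⁻¹ (conj ρ) = zeroOrder
χ ρ) and Re (1 − 1/ρ̄)ⁿ = Re (1 − 1/ρ)ⁿ, so the both-signs window trace of χ is the upper trace of χ
plus the upper trace of χ⁻¹. Second skeleton statement behind the route Assembly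
(assembly_of_supports; stub stub_window_conj). Sources: MontgomeryVaughan2007 §10.1; tree
DirichletXiConjugation (conj_dirichletXi), ExplicitFormulaPsiChar (lfunctionZeroBox). -/
@[route_item "route-RiemannHypothesis-LiDirichletEcho"]
def CharWindowConj : Prop :=
  ∀ (q : ℕ) [NeZero q] (χ : DirichletCharacter ℂ q), χ ≠ 1 → ∀ (n : ℕ) (T₁ T₂ : ℝ), 0 ≤ T₁ → T₁ ≤ T₂ → Summit.RiemannHypothesis.RiemannHypothesis.Theorems.LiTheory.charZeroTraceWindow χ n T₁ T₂ = Summit.RiemannHypothesis.RiemannHypothesis.Theorems.LiTheory.charUpperTraceWindow χ n T₁ T₂ + Summit.RiemannHypothesis.RiemannHypothesis.Theorems.LiTheory.charUpperTraceWindow χ⁻¹ n T₁ T₂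

-- `CharWindowConj` holds: proved by `Summit.RiemannHypothesis.RiemannHypothesis.Theorems.LiTheory.charWindowConj_proof` (its module imports this route file, so no `_holds` link can be stated here).

/-- item stmt-RiemannHypothesis-19402 · assembly · rank 1 · closed · proved by Summit.RiemannHypothesis.RiemannHypothesis.Theorems.LiTheory.liDirichletEcho_assembly_proof (prover) · by planner
sources: Bombieri2000Weil, Gonek1993
[assembly] LiWindowContourChar → LiPrimeEdgeEchoChar → LiGammaShiftChar → LiHorizontalEdgesChar →
the rung leaf LiZeroWindowEchoDirichlet (provable now from the two RH-free skeleton statements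
CharWindowAdjust, CharWindowConj; composition `assembly_of_supports` in
HOME/theory/route/p5/SketchAll.lean). -/
@[route_item "route-RiemannHypothesis-LiDirichletEcho", crux]
def Assembly : Prop :=
  LiWindowContourChar → LiPrimeEdgeEchoChar → LiGammaShiftChar → LiHorizontalEdgesChar → Summit.RiemannHypothesis.RiemannHypothesis.Theorems.LiTheory.LiZeroWindowEchoDirichlet

-- `Assembly` holds: proved by `Summit.RiemannHypothesis.RiemannHypothesis.Theorems.LiTheory.liDirichletEcho_assembly_proof` (its module imports this route file, so no `_holds` link can be stated here).

/-! D-0027 §2.1 — DECIDING THEOREM (planner-authored via `route open/edit --closes-file`; by planner-rh-li-theory-g7-0 2026-08-26T05:06:08Z) — ARCHIVED: route closed (proved) 2026-08-26T15:10:47Z; kept so importers keep building: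
its hypotheses are this route's items and its conclusion the registered leaf `Summit.RiemannHypothesis.RiemannHypothesis.Theorems.LiTheory.LiZeroWindowEchoDirichlet` (rung L-P(P1chi), D-0061) (glue_lint), and it elaborates with this file. -/

-- glue.lean — DECIDING THEOREM of route LiDirichletEcho (D-0027 §2.1; R5 shape, D-0061: concludes the RUNG LEAF
-- `Summit.RiemannHypothesis.RiemannHypothesis.Theorems.LiTheory.LiZeroWindowEchoDirichlet` («Li prime-echo law for Dirichlet characters»,
-- RH/GRH-FREE) BY NAME).  Hypotheses = the four crux decls + the provable-now Assembly item (its composition from two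
-- RH-free skeleton statements incl. the χ/χ̄ pairing is kernel-checked: HOME/theory/route/p5/SketchAll.lean
-- `assembly_of_supports`, farm rc 0); every binder is consumed (BC1: 5 binders, 4 open cruxes; BC6 clean).
@[closes "route-RiemannHypothesis-LiDirichletEcho"] theorem closes (h2 : LiPrimeEdgeEchoChar) (h3 : LiWindowContourChar) (h4 : LiGammaShiftChar) (h5 : LiHorizontalEdgesChar)
    (hA : Assembly) :
    Summit.RiemannHypothesis.RiemannHypothesis.Theorems.LiTheory.LiZeroWindowEchoDirichlet :=
  hA h3 h2 h4 h5

end Summit.RiemannHypothesis.RiemannHypothesis.Theses.LiDirichletEcho
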